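import Literature.NumberTheory.DiophantineGeometry.GenEllNorthcottProofs
import Literature.NumberTheory.DiophantineGeometry.GenEllThm21Finite
import HarnessLib

/-!
# [GenEll] Ex. 1.3 (i): Galois-finite sets — the instance forms print uses
# (kernel closure census of the predicate `IsGaloisFinite`, continued)

S. Mochizuki, *Arithmetic elliptic curves in general position*, Math. J. Okayama Univ. **52** (2010)
[cite: MochizukiGenEll2010], Ex. 1.3 (i) p. 5: "If `E ⊆ X(Q̄)` is a subset such that each `E^{≤d}` is
finite, then we shall say that `E` is *Galois-finite*"; Prop. 1.4 (iv) p. 6: "the set of points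
`x ∈ X(Q̄)^{≤d}` such that `ht_L̄(x) ≤ C` is finite"; Thm. 2.1 p. 11 (the inequality of BD-classes holds
on `K_V`, i.e. up to functions bounded on every `U^{≤d}`, so Galois-finite sets may be discarded).

PROOF-ONLY file (no definitions). `IsGaloisFinite` is a PREDICATE on subsets of `U_P(Q̄)` (a definition,
Ex. 1.3 (i)), not a published theorem; it sits in the abc-iut cell's frozen fact list as row F-1332.
Its UNIVERSAL CLOSURE is already REFUTED in the tree (`not_forall_isGaloisFinite`,
`not_isGaloisFinite_univ`, file `GenEllVocabularyClosures.lean`) and it is inhabited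
(`isGaloisFinite_empty`). This file adds the INSTANCE FORMS in which the paper actually uses the notion:

* closure properties — `HasFinitelyManyPoints.isGaloisFinite`, `isGaloisFinite_of_finite`,
  `IsGaloisFinite.mono`, `IsGaloisFinite.union`;
* **Prop. 1.4 (iv) in the language of Ex. 1.3 (i)** — the set of points of height `≤ C` is Galois-finite
  (`isGaloisFinite_setOf_ht_le`, from the landed Northcott theorem `northcott_UPle_holds`), hence so is
  every set on which the height is bounded (`IsGaloisFinite.of_ht_le`);
* the whole of `U_P(Q̄)`, indeed `U_P(Q̄)^{≤d}` for `d ≥ 1`, is NOT Galois-finite (`not_isGaloisFinite_UPle`,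
  `not_isGaloisFinite_UP`);
* **Thm. 2.1, "after possibly eliminating" a Galois-finite set** — the inequality of BD-classes on
  `S ∖ E` with `E` Galois-finite gives it on `S` (`IsGaloisFinite.vojtaIneq_of_diff`, from the landed
  `vojtaIneq_of_diff`).

Classical; nothing here bears on, or takes a side on, [IUTchIII] Cor. 3.12; a fact-list row is an
assumption label, not an endorsement; typed ≠ proved.
-/

noncomputable section

open Polynomial

namespace Literature.NumberTheory.DiophantineGeometry.GenEll

variable {S T : Set NFPoint}

/-! ## Closure properties -/

/-- A set with finitely many points is Galois-finite. [cite: MochizukiGenEll2010, Ex 1.3 (i) p.5] -/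
theorem HasFinitelyManyPoints.isGaloisFinite (h : HasFinitelyManyPoints S) : IsGaloisFinite S :=
  fun _ => h.mono Set.inter_subset_left

/-- A finite set of (presented) points is Galois-finite. [cite: MochizukiGenEll2010, Ex 1.3 (i) p.5] -/
theorem isGaloisFinite_of_finite (h : S.Finite) : IsGaloisFinite S :=
  HasFinitelyManyPoints.isGaloisFinite (h.image _)

/-- A subset of a Galois-finite set is Galois-finite. [cite: MochizukiGenEll2010, Ex 1.3 (i) p.5] -/
theorem IsGaloisFinite.mono (h : IsGaloisFinite T) (hST : S ⊆ T) : IsGaloisFinite S :=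
  fun d => (h d).mono (Set.inter_subset_inter_left _ hST)

/-- The union of two Galois-finite sets is Galois-finite. [cite: MochizukiGenEll2010, Ex 1.3 (i) p.5] -/
theorem IsGaloisFinite.union (hS : IsGaloisFinite S) (hT : IsGaloisFinite T) : IsGaloisFinite (S ∪ T) := by
  intro d
  unfold HasFinitelyManyPoints
  rw [Set.union_inter_distrib_right, Set.image_union]
  exact (hS d).union (hT d)

/-- A Galois-finite set has finitely many points in each degree (the definition, unfolded for use).
[cite: MochizukiGenEll2010, Ex 1.3 (i) p.5] -/
theorem IsGaloisFinite.hasFinitelyManyPoints_inter_UPle (h : IsGaloisFinite S) (d : ℕ) :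
    HasFinitelyManyPoints (S ∩ UPle d) :=
  h d

/-- A Galois-finite set contained in some `U_P(Q̄)^{≤d}` has finitely many points outright.
[cite: MochizukiGenEll2010, Ex 1.3 (i) p.5] -/
theorem IsGaloisFinite.hasFinitelyManyPoints_of_subset_UPle (h : IsGaloisFinite S) {d : ℕ}
    (hS : S ⊆ UPle d) : HasFinitelyManyPoints S :=
  (h d).mono fun _ hP => ⟨hP, hS hP⟩

/-! ## Prop. 1.4 (iv) = Northcott, in the language of Ex. 1.3 (i) -/

/-- **[GenEll] Prop. 1.4 (iv) for `(ℙ¹_ℚ, 𝒪(1))`, read through Ex. 1.3 (i)**: the set of points of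
`U_P(Q̄)` of height `≤ C` is Galois-finite — each `{x ∈ U_P(Q̄)^{≤d} : ht(x) ≤ C}` has finitely many points
(Northcott's theorem, the landed `northcott_UPle_holds`). [cite: MochizukiGenEll2010, Prop 1.4 (iv) p.6] -/
theorem isGaloisFinite_setOf_ht_le (C : ℝ) : IsGaloisFinite {P : NFPoint | P.ht ≤ C} :=
  fun d => (northcott_UPle_holds d C).mono fun _ hP => ⟨hP.2, hP.1⟩

/-- A set of points on which the height is bounded is Galois-finite (this is how [GenEll] Thm. 2.1 /
[IUTchIV] Cor. 2.2 (ii) dispose of their exceptional sets). [cite: MochizukiGenEll2010, Prop 1.4 (iv) p.6] -/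
theorem IsGaloisFinite.of_ht_le (C : ℝ) (h : ∀ P ∈ S, P.ht ≤ C) : IsGaloisFinite S :=
  (isGaloisFinite_setOf_ht_le C).mono h

/-! ## `U_P(Q̄)` itself is not Galois-finite -/

/-- `U_P(Q̄)^{≤ 1}` does not have finitely many points: the rational points `λ = n + 2`, `n ∈ ℕ`, have
the pairwise distinct minimal polynomials `X − (n + 2)`. [cite: MochizukiGenEll2010, Ex 1.3 (i) p.5] -/
theorem not_hasFinitelyManyPoints_UPle_one : ¬ HasFinitelyManyPoints (UPle 1) := by
  intro hfin
  have hsub : Set.range (fun n : ℕ => (X - C ((n : ℚ) + 2) : ℚ[X])) ⊆ NFPoint.mpoly '' UPle 1 := by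
    rintro _ ⟨n, rfl⟩
    have h0 : (n : ℚ) + 2 ≠ 0 := by positivity
    have h1 : (n : ℚ) + 2 ≠ 1 := by
      have : (1 : ℚ) < n + 2 := by linarith [n.cast_nonneg (α := ℚ)]
      exact this.ne'
    exact ⟨ratPoint ((n : ℚ) + 2), ratPoint_mem_UPle_one h0 h1, minpoly.eq_X_sub_C' _⟩
  have hinj : Function.Injective (fun n : ℕ => (X - C ((n : ℚ) + 2) : ℚ[X])) := by
    intro m n hmn
    have h0 := congr_arg (fun p : ℚ[X] => p.coeff 0) hmn
    simp only [coeff_sub, coeff_X_zero, coeff_C_zero, zero_sub, neg_inj, add_left_inj,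
      Nat.cast_inj] at h0
    exact h0
  exact (Set.infinite_range_of_injective hinj) (hfin.subset hsub)

/-- `U_P(Q̄)^{≤ d}` (`d ≥ 1`) is NOT Galois-finite. [cite: MochizukiGenEll2010, Ex 1.3 (i) p.5] -/
theorem not_isGaloisFinite_UPle {d : ℕ} (hd : 1 ≤ d) : ¬ IsGaloisFinite (UPle d) :=
  fun h => not_hasFinitelyManyPoints_UPle_one ((h 1).mono fun _ hP => ⟨UPle_mono hd hP, hP⟩)

/-- `U_P(Q̄)` is NOT Galois-finite. [cite: MochizukiGenEll2010, Ex 1.3 (i) p.5] -/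
theorem not_isGaloisFinite_UP : ¬ IsGaloisFinite UP :=
  fun h => not_isGaloisFinite_UPle le_rfl (h.mono (UPle_subset_UP 1))

/-- The predicate separates sets: some subsets of `U_P(Q̄)` are Galois-finite (`∅`, bounded-height sets)
and some are not (`U_P(Q̄)`), so F-1332 is vocabulary to be applied at instances — its universal closure
is refuted (`not_forall_isGaloisFinite`) and its negation's universal closure is refuted too.
[cite: MochizukiGenEll2010, Ex 1.3 (i) p.5] -/
theorem not_forall_not_isGaloisFinite : ¬ ∀ S : Set NFPoint, ¬ IsGaloisFinite S :=
  fun h => h _ (isGaloisFinite_setOf_ht_le 0)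

/-! ## Thm. 2.1: Galois-finite sets may be discarded -/

/-- **[GenEll] Thm. 2.1, "after possibly eliminating finitely many elements"**: the inequality of
BD-classes `VojtaIneq` ignores Galois-finite sets — if it holds on `S ∖ E` with `E` Galois-finite, it
holds on `S` (in every degree `d`; `1 + ε ≥ 0`). [cite: MochizukiGenEll2010, Thm 2.1 p.11] -/
theorem IsGaloisFinite.vojtaIneq_of_diff {E : Set NFPoint} {d : ℕ} {ε : ℝ} (hε : 0 ≤ 1 + ε)
    (hE : IsGaloisFinite E) (h : VojtaIneq (S \ E) d ε) : VojtaIneq S d ε :=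
  GenEll.vojtaIneq_of_diff hε (hE d) h

/-- In particular the inequality of BD-classes holds outright on every Galois-finite set.
[cite: MochizukiGenEll2010, Thm 2.1 p.11] -/
theorem IsGaloisFinite.vojtaIneq {d : ℕ} {ε : ℝ} (hε : 0 ≤ 1 + ε) (hS : IsGaloisFinite S) :
    VojtaIneq S d ε :=
  vojtaIneq_of_hasFinitelyManyPoints hε (hS d)

end Literature.NumberTheory.DiophantineGeometry.GenEll

end
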